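import Summits.QuantumFields.BalabanUV.Beta.CombRemainderTadpoleSlot
import Summits.QuantumFields.BalabanUV.Beta.CombLevelZeroT2Law
import Summits.QuantumFields.BalabanUV.Beta.SecondOrderStepRemainder
import Summits.QuantumFields.BalabanUV.Beta.CombChartSpreadBlind

/-!
# `BalabanUV.Beta.CombRemainderParityAll` — binder row D1, chart (III′), programme P5, brick P5-1: **THE SCALAR `hRm0` OF ROOT M″ IS A THEOREM AT EVERY LEVEL,
# AND THE (III′) REPAIR-TRACK ROOT HOLDS WITH IT DISCHARGED: `D1Drift (JsB12CombShSym …) ⟸ hΛ ∧ hcB ∧ D1Tel ∧ D1Rep` (ROOT M‴)**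

THE ARGUMENT (all [folklore] kernel algebra over OUR typed objects, BY NAME).
(1) P5-a `CombRemainderTadpoleSlot`: `tadpole G′_j (Rm_j) = ½·(tadpole G′_j (vertex2OfK G′_j Lc (combR2An1 … j α) μ y ν y′) + swap)` — only the T2-remainder slot
    can contribute (`hRm0_of_hR2tad`).
(2) P5-0b `CombLevelZeroT2Law`: `combR2An1 … 0 = 0` (the level-0 second-order table obeys its reflection law exactly).
(3) §1 HERE: in chart (III′) the chart-conjugation SANDWICH DEFECTS VANISH — `sandwichDefect G′_j 𝕄_j X = 0` for every localised `X` commuting with the coordinate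
    slice (the sandwiched rules `rule_left_rel` ∕ `rule_right_rel` of `RelInv G′_j 𝕄_j (axEc ρ_c)`, P2 `relInv_coDressKAt_Gsym_bhKStepSh`; an3 XAN262 §4's «no `conjDefect`
    word in chart (III′)», now for the W-recursion's cross words too); so P6-8's transport `hR2succ_comb` COLLAPSES to leaf-05 g5's hereditary shape
    `R2_{j+1} = −(cE₂·wV4 (j+1)) • mmRead (G′_j ∘ Rm_j ∘ G′_j) + 0 + conjV (mmRead G′_j) (diagK …)`.
(4) §3: INDUCTION ON THE LEVEL — `trK (combR2An1 … j α κ u κ′ u′) = −sgnK (…)` for all `j` (base (2); step: `Rm_j` is parity-odd because the split defect is —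
    `parityOdd_combΔAn1_of_R2`: `[𝕄_j, diagK X♯]` by `SecondOrderStepRemainder.parityOdd_conjV_diagK_of_even` + §2 `trK_bhKStepSh_all`, `dM (…) S_j M1_j` by
    `SpineRecursiveParity.parityOdd_dM` + `trK_SpureRecOf` ∕ `trK_M1Of_symHessFFAt`, the slots by leaf-05's `trK_vertex2OfK_of_rows` (induction hypothesis) ∕
    `trK_mixOfK_of_rows` (P5-a `trK_symRMrAn1` at the lock) — then `parityOdd_mmRead_sandwich` ∕ `parityOdd_conjV_mmRead_diagK`).
(5) §4: row parity + the `LocStencil₂` class (`CombSecondOrderDeltaSep.locStencil₂_combR2An1`) + `G′_j` spread and sgn-symmetric (`trK_GcombSh`) ⟹ the slot tadpoles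
    vanish (`SecondOrderRemainderTables.tadpole_vertex2OfK_eq_zero`): `hR2tad_all`; with (1): **`hRm0_discharged`** = ROOT M″'s binder `hRm0` VERBATIM, ∀ `j α μ y ν y′`,
    under M″'s own `Odd Lc`, `2 ≤ N`, `hΛ : cΛ·Lc⁴ = 2`.
(6) §5 **ROOT M‴ `d1Drift_JsB12CombShSym_an1TablesS2_pinned_of_locks_D1Tel_D1Rep`** = ROOT M″ (`CombChartJointEndReflTablesAn1S2N`) by ONE `exact` with slot `hRm0 :=
    hRm0_discharged hLc hN hΛ`: `D1Drift Lc (JsB12CombShSym hLc N (symTablesAn1S2 3 Lc cΛ) cΛ cB) Nc μ ν ⟸ hΛ ∧ hcB ∧ D1Tel ∧ D1Rep` (+ the route theorem's own binders).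

WHAT THIS MEANS FOR THE ROW (owner's census words, to be read by the REFEREE — not adjudicated here): for the chart-(III′) literal `JsB12CombShSym` at an1's tables
`symTablesAn1S2`, the reflection-covariance binder hR of `OneStepKernelFamily.d1Drift_of_D1Tel_D1Rep` is now DISCHARGED IN THE KERNEL (its table letters were theorems
since P6; its one scalar `hRm0` is (5)); hW was table letters (theorems) since F‴∕F⁗.  The repair-track root classes {hW, hR, D1Tel, D1Rep} stand 2∕4 by theorems,
with `D1Tel` (road FP, d1-p3) and `D1Rep` (road BF-x, d1-p2) OPEN and displayed, plus the two numeral locks `hΛ`, `hcB` of an1's table fit.  Engine C's (E0)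
(R-D1-HRM0-E0, `ttrl/requests.jsonl` l.2727 ∕ l.2763) is PREDICTED ≡ 0 at every level by the kernel.
WHAT THIS IS NOT: not a statement about Bałaban's papers; not ROOT M′∕N (chart (II), whose `hcomp` is refuted at level 0 of record — the kernel now SEPARATES the two
charts: the (III′) remainder tadpole is 0 by theorem where the (II) scalar is false by engine, the difference being exactly the vanishing of the sandwich defects (3));
not `D1Tel`, not `D1Rep`; NOT D1, NOT `BetaPertH`, NOT continuum, NOT Clay.  The ROOT OF RECORD is the referee's to name.
HONEST FRAMING (cell contract, verbatim): «discharging `BetaPertH` makes Bałaban's UV stability UNCONDITIONAL — a real constructive-QFT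
result; it is NOT the continuum limit and NOT the Clay problem.»  HONEST DEPENDENCY: continuum YM on T⁴ ⇐ BetaPertH ∧ nine spine estimates (0/9 proved);
BetaPertH ⇐ (D1) ∧ (D4) ∧ CAP+tail; G-an2-4 gates asym, D1 and NE2/3/4.
DERIVED cell leaf ([folklore] BY NAME; β sub-cell, BINDER-OWNERS row D1 OWNER `b2b-balaban-beta-an2` gen 38).  No statement of Bałaban's papers, no `[cite:]`, no
`Prop` fact, no `def`.  Provenance: β sub-cell, unit beta-an2 gen 38, 2026-08-22 (v1); over P5-a, P5-0b (this gen), P6-8 `CombSecondOrderRemainderAn1` (gen 36∕37),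
leaf-05 g5 `SecondOrderStepRemainder` ∕ `SecondOrderRemainderTables`, `ChartConjugationRelative` (gen 17), `CombChartSpreadBlind` (leaf-03 g19), M″ (gen 37) BY NAME;
no existing file touched.
-/

noncomputable section

open Finset
open scoped BigOperators
open Literature.MathematicalPhysics.QuantumFieldTheory
open Literature.MathematicalPhysics.QuantumFieldTheory.Balaban1983to89
open Literature.MathematicalPhysics.QuantumFieldTheory.Balaban1983to89.Beta
open ExpKernelCalculus (MKer Decays BiLoc comp tadpole)
open PolarizationSign (reflSign)
open AveragingContoursRooted (ctr ctrOff ctrOff_mem_box)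
open OneStepResolventKernel (Fib LocStencil decays_mono)
open OneStepKernelFamily (colH vertexOfK)
open BalabanStepJetsSucc (wVH mmRead)
open BalabanStepW2 (wM1 wM2 wV4 M2Of)
open BalabanCompositeJets (LocStencil₂)
open SecondOrderResponse (dM K2OfK vertex2OfK mixOfK)
open WilsonVertex2Sym (wsym22)
open StepDriftWitness (comp_zero_right)
open Summit.QuantumFields.BalabanUV.Beta.TameKernelCalculus
open Summit.QuantumFields.BalabanUV.Beta.ChartConjugation (conjV conjW loc_conjV)
open Summit.QuantumFields.BalabanUV.Beta.ChartConjugationDefectEnd (sandwichDefect)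
open Summit.QuantumFields.BalabanUV.Beta.ChartConjugationRelative (RelInv rule_left_rel rule_right_rel spr_comp)
open Summit.QuantumFields.BalabanUV.Beta.KernelWardRelative (conjV_zero comp_zero_left)
open Summit.QuantumFields.BalabanUV.Beta.KernelWardRemainderParity (parityOdd_add)
open Summit.QuantumFields.BalabanUV.Beta.AxialDressingRooted (one_le_of_neZero axEc spr_axEc)
open Summit.QuantumFields.BalabanUV.Beta.SymShiftedSpread (bhKStepSh bhKStepSh_zero spr_bhKStepSh)
open Summit.QuantumFields.BalabanUV.Beta.BorderedHessian (sgnK sgnK_apply sgnF sgnF_inl sgnF_inr bhK trK_bhK stepScale diagK comp_axEc_diagK_comm)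
open Summit.QuantumFields.BalabanUV.Beta.E3ContactGenerator (ctGenM)
open Summit.QuantumFields.BalabanUV.Beta.DshAn1 (Dsh spr_Dsh Dsh_inr_inl_eq_neg Dsh_inl_inl Dsh_inr_inr)
open Summit.QuantumFields.BalabanUV.Beta.SymAveragingHessianCounts (symVhSAt symHessFFAt)
open Summit.QuantumFields.BalabanUV.Beta.SymAveragingMixedJetTables (symMixFFAt)
open Summit.QuantumFields.BalabanUV.Beta.SymSecondOrderTablesAn1 (symVh₂SAn1)
open Summit.QuantumFields.BalabanUV.Beta.SymMixedReflectionLetterAn1 (symRMrAn1)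
open Summit.QuantumFields.BalabanUV.Beta.SpineRecursiveParity (parityOdd_smul parityOdd_zero parityOdd_dM)
open Summit.QuantumFields.BalabanUV.Beta.SymTablesAn1FirstOrder (trK_symVhSAt trK_symHessFFAt trK_M1Of_symHessFFAt)
open Summit.QuantumFields.BalabanUV.Beta.SymmetrisedStepJetsParity (trK_SpureRecOf)
open Summit.QuantumFields.BalabanUV.Beta.SymAveragingHessianCounts (symVhSAt_hV_ctr symHessFFAt_hH_ctr)
open Summit.QuantumFields.BalabanUV.Beta.SecondOrderRemainderTables (trK_vertex2OfK_of_rows trK_mixOfK_of_rows tadpole_vertex2OfK_eq_zero)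
open Summit.QuantumFields.BalabanUV.Beta.SecondOrderStepRemainder (parityOdd_conjV_diagK_of_even parityOdd_conjV_mmRead_diagK parityOdd_mmRead_sandwich)
open Summit.QuantumFields.BalabanUV.Beta.CombChartStepJets (GcombSh decays_GcombSh)
open Summit.QuantumFields.BalabanUV.Beta.CombChartWardSockets (trK_GcombSh)
open Summit.QuantumFields.BalabanUV.Beta.CombChartContactFactor (spr_GcombSh)
open Summit.QuantumFields.BalabanUV.Beta.CombChartSpreadBlind (trK_bhKStepSh_succ)
open Summit.QuantumFields.BalabanUV.Beta.RelInvCombShiftedSpread (relInv_coDressKAt_Gsym_bhKStepSh)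
open Summit.QuantumFields.BalabanUV.Beta.SpineRooted (M1Of SpureRecOf T2RecOf)
open Summit.QuantumFields.BalabanUV.Beta.CombSecondOrderRemainderAn1 (combΔOfAt combR2An1 combΔAn1 hR2succ_comb)
open Summit.QuantumFields.BalabanUV.Beta.CombSecondOrderDeltaSep (comb_letters_common combΔOfAt_eq_sharp locStencil₂_combR2An1 hΔL_pinned)
open Summit.QuantumFields.BalabanUV.Beta.SecondOrderSplitLoc (loc_diagK_dressed)
open Summit.QuantumFields.BalabanUV.Beta.SpineRecursiveParity (parityOdd_neg)
open Summit.QuantumFields.BalabanUV.Beta.SymSecondOrderDeltaSep (sep_zeroTable)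
open Summit.QuantumFields.BalabanUV.Beta.CombRemainderTadpoleSlot (trK_symRMrAn1 conjW_sub_conjW diagK_zeroTable diagK_zeroTable_sub lock_of_hΛ hRm0_of_hR2tad)
open Summit.QuantumFields.BalabanUV.Beta.CombChartJointEnd (JsB12CombShSym)
open Summit.QuantumFields.BalabanUV.Beta.SymSecondOrderTablesAn1 (symTablesAn1S2)
open Summit.QuantumFields.BalabanUV.Beta.CombChartJointEndReflTablesAn1S2N (d1Drift_JsB12CombShSym_an1TablesS2_pinned_of_locks_hcomp_D1Tel_D1Rep)
open Literature.MathematicalPhysics.QuantumFieldTheory.Balaban1983to89.Beta.VectorTailsLoc (fam kfam)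
open Literature.MathematicalPhysics.QuantumFieldTheory.Balaban1983to89.Beta.VectorLegVolumeAdapter (MvE)
open OneStepResolventKernel (JetData)
open OneStepKernelFamily (D1Tel D1Rep D1Drift)
open Summit.QuantumFields.BalabanUV.Beta.CombLevelZeroT2Law (combR2An1_zero_eq_zero)

namespace Summit.QuantumFields.BalabanUV.Beta.CombRemainderParityAll

variable {Lc : ℕ} [NeZero Lc]

/-! ## §1 In chart (III′) the chart-conjugation SANDWICH DEFECT of a diagonal contact VANISHES (relative-inverse rules) -/

/-- [folklore] **`sandwichDefect G′_j 𝕄_j X = 0` FOR EVERY LOCALISED `X` COMMUTING WITH THE COORDINATE SLICE**: `G′(𝕄X)G′ = XG′` and `G′(X𝕄)G′ = G′X` by the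
sandwiched rules of `RelInv G′_j 𝕄_j (axEc ρ_c)` (`ChartConjugationRelative.rule_left_rel` ∕ `rule_right_rel`), so `G′[𝕄,X]G′ = −[G′,X]`. -/
theorem sandwichDefect_eq_zero (j : ℕ) {X : MKer 4 (Fib 3)} (hX : Loc X) (hEX : comp (axEc (ctr 4 Lc) Lc) X = comp X (axEc (ctr 4 Lc) Lc)) :
    sandwichDefect (GcombSh Lc j) (bhKStepSh 3 Lc (Dsh Lc) j) X = 0 := by
  have hL1 : 1 ≤ Lc := one_le_of_neZero Lc
  have hA : Spr (GcombSh (d := 3) Lc j) := spr_GcombSh (d := 3) (Lc := Lc) j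
  have hM : Spr (bhKStepSh 3 Lc (Dsh Lc) j) := spr_bhKStepSh (spr_Dsh hL1) j
  have hE : Spr (axEc (d := 3) (ctr 4 Lc) Lc) := spr_axEc _ _
  have hR : RelInv (GcombSh (d := 3) Lc j) (bhKStepSh 3 Lc (Dsh Lc) j) (axEc (ctr 4 Lc) Lc) := relInv_coDressKAt_Gsym_bhKStepSh (d := 3) (Lc := Lc) j
  have hMX : Loc (comp (bhKStepSh 3 Lc (Dsh Lc) j) X) := hM.comp_loc hX
  have hXM : Loc (comp X (bhKStepSh 3 Lc (Dsh Lc) j)) := hX.comp_spr hM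
  have t1 : comp (comp (GcombSh Lc j) (comp (bhKStepSh 3 Lc (Dsh Lc) j) X)) (GcombSh Lc j) = comp X (GcombSh Lc j) := by
    rw [comp_assoc_tame hA.tame hM.tame hX.tame, ← comp_assoc_tame (spr_comp hA hM).tame hX.tame hA.tame, rule_left_rel hA hM hE hR hX hEX]
  have t2 : comp (comp (GcombSh Lc j) (comp X (bhKStepSh 3 Lc (Dsh Lc) j))) (GcombSh Lc j) = comp (GcombSh Lc j) X := by
    rw [comp_assoc_tame hA.tame hX.tame hM.tame, ← comp_assoc_tame (hA.comp_loc hX).tame hM.tame hA.tame, rule_right_rel hA hM hE hR hX hEX]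
  unfold ChartConjugationDefectEnd.sandwichDefect ChartConjugation.conjV
  rw [comp_sub_right_tame hA.tame hMX.tame hXM.tame, comp_sub_left_tame (hA.comp_loc hMX).tame (hA.comp_loc hXM).tame hA.tame, t1, t2]
  abel

/-- [folklore] … in particular for every localised diagonal contact (`DiagonalContact.comp_axEc_diagK_comm`). -/
theorem sandwichDefect_diagK_eq_zero (j : ℕ) {g : (Fin 4 → ℤ) → Fib 3 → ℝ} (hg : Loc (diagK g)) :
    sandwichDefect (GcombSh Lc j) (bhKStepSh 3 Lc (Dsh Lc) j) (diagK g) = 0 :=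
  sandwichDefect_eq_zero j hg (comp_axEc_diagK_comm _ _ _)

/-! ## §2 The legged border is sgn-symmetric at every level -/

/-- [folklore] `trK (bhKStepSh 3 Lc (Dsh Lc) j) = sgnK (…)` for EVERY `j` (`j+1`: `CombChartSpreadBlind.trK_bhKStepSh_succ`; `0`: `bhK + Dsh`, `trK_bhK` and
the antisymmetric placement of `Dsh`). -/
theorem trK_bhKStepSh_all : ∀ j : ℕ, trK (bhKStepSh 3 Lc (Dsh Lc) j) = sgnK (bhKStepSh 3 Lc (Dsh Lc) j)
  | 0 => by
    funext x y a b
    rw [bhKStepSh_zero, trK_add]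
    have hb := congrArg (fun K => K x y a b) (trK_bhK (d := 3) Lc)
    simp only [trK_apply, sgnK_apply] at hb
    simp only [Pi.add_apply, trK_apply, sgnK_apply]
    rcases a with κ | κ <;> rcases b with l | l
    · simp [hb]
    · rw [Dsh_inr_inl_eq_neg, hb]; simp only [sgnF_inl, sgnF_inr]; ring
    · rw [Dsh_inr_inl_eq_neg, hb]; simp only [sgnF_inl, sgnF_inr]; ring
    · simp [hb]
  | j + 1 => trK_bhKStepSh_succ (d := 3) (Lc := Lc) j

/-! ## §3 THE INDUCTION: the (hT2-rem) remainder and the split defect are ROW-PARITY-ODD at every level -/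

/-- [folklore] **THE SPLIT DEFECT IS ROW-PARITY-ODD ONCE THE T2-REMAINDER IS** (level `j`, at the pin and the weight lock): by `combΔOfAt_eq_sharp` the defect is
`[𝕄_j, diagK X♯]` (parity-odd: `SecondOrderStepRemainder.parityOdd_conjV_diagK_of_even` + §2) `+ dM (…) S_j M1_j` (`SpineRecursiveParity.parityOdd_dM` + first-order
row parities) `+` the two slots (leaf-05's `trK_vertex2OfK_of_rows` ∕ `trK_mixOfK_of_rows`, fed by the hypothesis and by P5-a's `trK_symRMrAn1`). -/
theorem parityOdd_combΔAn1_of_R2 {cΛ : ℝ} {γ : ℕ → ℝ} (hw : ∀ j, cΛ * wM1 3 Lc j * γ j = -wM2 3 Lc j) (N j : ℕ) (α : Fin 4)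
    (hR2 : ∀ (κ : Fin 4) (u : Fin 4 → ℤ) (κ' : Fin 4) (u' : Fin 4 → ℤ),
      trK (combR2An1 Lc N cΛ γ (0 : ℕ → Fin 4 → Fin 4 → (Fin 4 → ℤ) → Fin 4 → (Fin 4 → ℤ) → (Fin 4 → ℤ) → Fib 3 → ℝ) j α κ u κ' u') =
        -sgnK (combR2An1 Lc N cΛ γ (0 : ℕ → Fin 4 → Fin 4 → (Fin 4 → ℤ) → Fin 4 → (Fin 4 → ℤ) → (Fin 4 → ℤ) → Fib 3 → ℝ) j α κ u κ' u'))
    (μ : Fin 4) (y : Fin 4 → ℤ) (ν : Fin 4) (y' : Fin 4 → ℤ) :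
    trK (combΔAn1 Lc N cΛ γ (0 : ℕ → Fin 4 → Fin 4 → (Fin 4 → ℤ) → Fin 4 → (Fin 4 → ℤ) → (Fin 4 → ℤ) → Fib 3 → ℝ) j α μ y ν y') =
      -sgnK (combΔAn1 Lc N cΛ γ (0 : ℕ → Fin 4 → Fin 4 → (Fin 4 → ℤ) → Fin 4 → (Fin 4 → ℤ) → (Fin 4 → ℤ) → Fib 3 → ℝ) j α μ y ν y') := by
  have hL1 : 1 ≤ Lc := one_le_of_neZero Lc
  have hR2c : ∃ C δ : ℝ, 0 < δ ∧ LocStencil₂ (combR2An1 Lc N cΛ γ (0 : ℕ → Fin 4 → Fin 4 → (Fin 4 → ℤ) → Fin 4 → (Fin 4 → ℤ) → (Fin 4 → ℤ) → Fib 3 → ℝ) j α) C δ :=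
    locStencil₂_combR2An1 (Lc := Lc) N cΛ γ 0 α (fun j' => sep_zeroTable (Lc := Lc) j' α) j
  have e : combΔAn1 Lc N cΛ γ (0 : ℕ → Fin 4 → Fin 4 → (Fin 4 → ℤ) → Fin 4 → (Fin 4 → ℤ) → (Fin 4 → ℤ) → Fib 3 → ℝ) j α μ y ν y' =
      combΔOfAt Lc N cΛ γ 0 j (combR2An1 Lc N cΛ γ 0 j) α μ y ν y' := rfl
  have halg : ∀ (A B C D : MKer 4 (Fib 3)), A + B + C - D = (A - D) + B + C := fun _ _ _ _ => by abel
  rw [e, combΔOfAt_eq_sharp (Lc := Lc) N cΛ γ 0 j (Rj := combR2An1 Lc N cΛ γ 0 j) α hR2c μ y ν y', halg, conjW_sub_conjW, diagK_zeroTable,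
    conjV_zero, sub_zero]
  have hS : ∀ (κ : Fin 4) (u : Fin 4 → ℤ), trK (SpureRecOf 3 Lc (symVhSAt (ctr 4 Lc) 3 Lc rfl) (symHessFFAt (ctr 4 Lc) Lc) (GcombSh Lc) ((Lc : ℝ) ^ 4) (-((Lc : ℝ) ^ 8 / 2)) cΛ j κ u) =
      -sgnK (SpureRecOf 3 Lc (symVhSAt (ctr 4 Lc) 3 Lc rfl) (symHessFFAt (ctr 4 Lc) Lc) (GcombSh Lc) ((Lc : ℝ) ^ 4) (-((Lc : ℝ) ^ 8 / 2)) cΛ j κ u) :=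
    fun κ u => trK_SpureRecOf (d := 3) (symVhSAt_hV_ctr (d := 3) hL1) (symHessFFAt_hH_ctr (d := 3) hL1) (decays_GcombSh Lc)
      (fun j' => trK_GcombSh (d := 3) (Lc := Lc) j') (fun κ u => trK_symVhSAt _ _ κ u) (fun μ y => trK_symHessFFAt _ _ μ y) _ _ cΛ j κ u
  have hM : ∀ (ρ : Fin 4) (w : Fin 4 → ℤ), trK (M1Of 3 Lc (symHessFFAt (ctr 4 Lc) Lc) cΛ j ρ w) = -sgnK (M1Of 3 Lc (symHessFFAt (ctr 4 Lc) Lc) cΛ j ρ w) :=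
    fun ρ w => trK_M1Of_symHessFFAt (d := 3) _ cΛ j ρ w
  exact parityOdd_add (parityOdd_add (parityOdd_conjV_diagK_of_even _ (trK_bhKStepSh_all (Lc := Lc) j)) (parityOdd_dM _ _ hS hM μ y))
    (parityOdd_add (trK_vertex2OfK_of_rows _ hR2 μ y ν y')
      (parityOdd_add (trK_mixOfK_of_rows _ (fun κ u ρ w => trK_symRMrAn1 (hw j) α κ u ρ w) μ y ν y')
        (trK_mixOfK_of_rows _ (fun κ u ρ w => trK_symRMrAn1 (hw j) α κ u ρ w) ν y' μ y)))

/-- [folklore] **THE (hT2-rem) REMAINDER OF THE (III′) REPAIR TRACK IS ROW-PARITY-ODD AT EVERY LEVEL** (`Lc` odd, `2 ≤ N`, the pinned `γ_j`, the weight lock):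
induction on the level — base `CombLevelZeroT2Law.combR2An1_zero_eq_zero`; step = P6-8's `hR2succ_comb` in which the four chart-conjugation SANDWICH-DEFECT
words VANISH (§1), leaving leaf-05's hereditary shape `−(c • mmRead (G′_j ∘ Rm_j ∘ G′_j)) + 0 + conjV (mmRead G′_j) (diagK …)`
(`SecondOrderStepRemainder.parityOdd_mmRead_sandwich` ∕ `parityOdd_conjV_mmRead_diagK`) with `Rm_j` parity-odd by `parityOdd_combΔAn1_of_R2`. -/
theorem trK_combR2An1 (hLc : Odd Lc) {N : ℕ} (hN : 2 ≤ N) {cΛ : ℝ} (hw : ∀ j, cΛ * wM1 3 Lc j * (-((Lc : ℝ) ^ 8 / 2) * wVH 3 Lc j / (stepScale 3 Lc j * (Lc : ℝ) ^ 4)) = -wM2 3 Lc j) :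
    ∀ (j : ℕ) (α κ : Fin 4) (u : Fin 4 → ℤ) (κ' : Fin 4) (u' : Fin 4 → ℤ),
      trK (combR2An1 Lc N cΛ (fun j => -((Lc : ℝ) ^ 8 / 2) * wVH 3 Lc j / (stepScale 3 Lc j * (Lc : ℝ) ^ 4)) (0 : ℕ → Fin 4 → Fin 4 → (Fin 4 → ℤ) → Fin 4 → (Fin 4 → ℤ) → (Fin 4 → ℤ) → Fib 3 → ℝ) j α κ u κ' u') =
        -sgnK (combR2An1 Lc N cΛ (fun j => -((Lc : ℝ) ^ 8 / 2) * wVH 3 Lc j / (stepScale 3 Lc j * (Lc : ℝ) ^ 4)) (0 : ℕ → Fin 4 → Fin 4 → (Fin 4 → ℤ) → Fin 4 → (Fin 4 → ℤ) → (Fin 4 → ℤ) → Fib 3 → ℝ) j α κ u κ' u') := by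
  have hL1 : 1 ≤ Lc := one_le_of_neZero Lc
  intro j
  induction j with
  | zero =>
    intro α κ u κ' u'
    rw [combR2An1_zero_eq_zero (Lc := Lc) hLc hN cΛ _ (fun _ => rfl)]
    exact parityOdd_zero
  | succ j ih =>
    intro α κ u κ' u'
    have hA : Spr (GcombSh (d := 3) Lc j) := spr_GcombSh (d := 3) (Lc := Lc) j
    -- the diagonal dressed contact is localised
    obtain ⟨m, C, Cs, CM, Cg, hm, hC, hG, hS, hM1, hgl⟩ := comb_letters_common (Lc := Lc) cΛ (fun j => -((Lc : ℝ) ^ 8 / 2) * wVH 3 Lc j / (stepScale 3 Lc j * (Lc : ℝ) ^ 4)) j α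
    have hΞ : ∀ (κ₀ : Fin 4) (u₀ : Fin 4 → ℤ), Loc (diagK fun p c => ∑ ι, ∑' v, colH (GcombSh Lc j) Lc κ₀ u₀ ι v *
        ((fun j => -((Lc : ℝ) ^ 8 / 2) * wVH 3 Lc j / (stepScale 3 Lc j * (Lc : ℝ) ^ 4)) j * ctGenM 3 (bhK Lc + Dsh Lc) α Lc ι v p c)) :=
      fun κ₀ u₀ => loc_diagK_dressed (N := Lc) ⟨m, C, hm, hC, hG⟩ hgl hm κ₀ u₀
    -- the W-remainder at level j: localised and parity-odd
    have hΔ := hΔL_pinned (Lc := Lc) N cΛ (fun j => -((Lc : ℝ) ^ 8 / 2) * wVH 3 Lc j / (stepScale 3 Lc j * (Lc : ℝ) ^ 4))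
    have hRmL : Loc ((1 / 2 : ℝ) • (combΔAn1 Lc N cΛ (fun j => -((Lc : ℝ) ^ 8 / 2) * wVH 3 Lc j / (stepScale 3 Lc j * (Lc : ℝ) ^ 4)) 0 j α κ u κ' u' +
        combΔAn1 Lc N cΛ (fun j => -((Lc : ℝ) ^ 8 / 2) * wVH 3 Lc j / (stepScale 3 Lc j * (Lc : ℝ) ^ 4)) 0 j α κ' u' κ u)) :=
      ((hΔ j α κ u κ' u').add (hΔ j α κ' u' κ u)).smul _
    have hRmP : trK ((1 / 2 : ℝ) • (combΔAn1 Lc N cΛ (fun j => -((Lc : ℝ) ^ 8 / 2) * wVH 3 Lc j / (stepScale 3 Lc j * (Lc : ℝ) ^ 4)) 0 j α κ u κ' u' +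
        combΔAn1 Lc N cΛ (fun j => -((Lc : ℝ) ^ 8 / 2) * wVH 3 Lc j / (stepScale 3 Lc j * (Lc : ℝ) ^ 4)) 0 j α κ' u' κ u)) =
        -sgnK ((1 / 2 : ℝ) • (combΔAn1 Lc N cΛ (fun j => -((Lc : ℝ) ^ 8 / 2) * wVH 3 Lc j / (stepScale 3 Lc j * (Lc : ℝ) ^ 4)) 0 j α κ u κ' u' +
        combΔAn1 Lc N cΛ (fun j => -((Lc : ℝ) ^ 8 / 2) * wVH 3 Lc j / (stepScale 3 Lc j * (Lc : ℝ) ^ 4)) 0 j α κ' u' κ u)) :=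
      parityOdd_smul _ (parityOdd_add (parityOdd_combΔAn1_of_R2 (Lc := Lc) hw N j α (ih α) κ u κ' u') (parityOdd_combΔAn1_of_R2 (Lc := Lc) hw N j α (ih α) κ' u' κ u))
    rw [hR2succ_comb N cΛ _ 0 j α κ u κ' u', sandwichDefect_diagK_eq_zero j (hΞ κ u), sandwichDefect_diagK_eq_zero j (hΞ κ' u'), comp_zero_left, comp_zero_left,
      comp_zero_right, comp_zero_right, add_zero, add_zero, add_zero, sub_zero, diagK_zeroTable_sub, conjV_zero, smul_zero, zero_add,
      show (0 : ℕ → Fin 4 → Fin 4 → (Fin 4 → ℤ) → Fin 4 → (Fin 4 → ℤ) → MKer 4 (Fib 3)) (j + 1) α κ u κ' u' = 0 from rfl, add_zero]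
    exact parityOdd_add (parityOdd_neg (parityOdd_smul _ (parityOdd_mmRead_sandwich Lc hA (trK_GcombSh (d := 3) (Lc := Lc) j) hRmL hRmP)))
      (parityOdd_conjV_mmRead_diagK Lc _ (trK_GcombSh (d := 3) (Lc := Lc) j))

/-! ## §4 `hR2tad` AT EVERY LEVEL, and ROOT M″'s `hRm0` — DISCHARGED -/

/-- [folklore] **THE T2-REMAINDER SLOT IDENTITY `hR2tad` HOLDS AT EVERY LEVEL** (leaf-05's `SecondOrderRemainderTables.tadpole_vertex2OfK_eq_zero`: spread
sgn-symmetric `G′_j`, the `LocStencil₂` class `CombSecondOrderDeltaSep.locStencil₂_combR2An1` at the pin, row parity §3). -/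
theorem hR2tad_all (hLc : Odd Lc) {N : ℕ} (hN : 2 ≤ N) {cΛ : ℝ} (hΛ : cΛ * (Lc : ℝ) ^ 4 = 2) :
    ∀ (j : ℕ) (α μ : Fin 4) (y : Fin 4 → ℤ) (ν : Fin 4) (y' : Fin 4 → ℤ),
      tadpole (GcombSh Lc j) (vertex2OfK (GcombSh (d := 3) Lc j) Lc
          (combR2An1 Lc N cΛ (fun j => -((Lc : ℝ) ^ 8 / 2) * wVH 3 Lc j / (stepScale 3 Lc j * (Lc : ℝ) ^ 4)) (0 : ℕ → Fin 4 → Fin 4 → (Fin 4 → ℤ) → Fin 4 → (Fin 4 → ℤ) → (Fin 4 → ℤ) → Fib 3 → ℝ) j α) μ y ν y') +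
        tadpole (GcombSh Lc j) (vertex2OfK (GcombSh (d := 3) Lc j) Lc
          (combR2An1 Lc N cΛ (fun j => -((Lc : ℝ) ^ 8 / 2) * wVH 3 Lc j / (stepScale 3 Lc j * (Lc : ℝ) ^ 4)) (0 : ℕ → Fin 4 → Fin 4 → (Fin 4 → ℤ) → Fin 4 → (Fin 4 → ℤ) → (Fin 4 → ℤ) → Fib 3 → ℝ) j α) ν y' μ y) = 0 := by
  intro j α μ y ν y'
  obtain ⟨δ, C, hδ, hC, hG⟩ := decays_GcombSh (d := 3) Lc j
  obtain ⟨C₂, δ₂, hδ₂, hR₂⟩ := locStencil₂_combR2An1 (Lc := Lc) N cΛ (fun j => -((Lc : ℝ) ^ 8 / 2) * wVH 3 Lc j / (stepScale 3 Lc j * (Lc : ℝ) ^ 4)) 0 α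
    (fun j' => sep_zeroTable (Lc := Lc) j' α) j
  have hm : 0 < min δ δ₂ := lt_min hδ hδ₂
  have hpar := trK_combR2An1 (Lc := Lc) hLc hN (fun j' => lock_of_hΛ (Lc := Lc) hΛ j') j α
  rw [tadpole_vertex2OfK_eq_zero (spr_GcombSh (d := 3) (Lc := Lc) j) (trK_GcombSh (d := 3) (Lc := Lc) j) (decays_mono hG hC le_rfl (min_le_left _ _)) hC hm
      (hR₂.mono (min_le_right _ _)) hpar μ y ν y',
    tadpole_vertex2OfK_eq_zero (spr_GcombSh (d := 3) (Lc := Lc) j) (trK_GcombSh (d := 3) (Lc := Lc) j) (decays_mono hG hC le_rfl (min_le_left _ _)) hC hm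
      (hR₂.mono (min_le_right _ _)) hpar ν y' μ y, add_zero]

/-- **ROW D1, CHART (III′): ROOT M″'s SCALAR `hRm0` — DISCHARGED.**  For `Lc` odd, `2 ≤ N`, the lock `hΛ : cΛ·Lc⁴ = 2`: for EVERY level `j`, axis `α` and pair of
coarse bonds, `tadpole (GcombSh Lc j) (Rm_j α μ y ν y′) = 0` — M″'s binder `hRm0` VERBATIM (`X2s := 0`, `γ_j` pinned), now a theorem
(P5-a `CombRemainderTadpoleSlot.hRm0_of_hR2tad` ∘ `hR2tad_all`).  HONEST: [folklore] kernel algebra over OUR typed objects; ONE displayed binder of the repair-track root is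
PROVED; `D1Tel`, `D1Rep` remain; nothing of Bałaban's asserted; NOT D1. -/
theorem hRm0_discharged (hLc : Odd Lc) {N : ℕ} (hN : 2 ≤ N) {cΛ : ℝ} (hΛ : cΛ * (Lc : ℝ) ^ 4 = 2) :
    ∀ (j : ℕ) (α μ : Fin 4) (y : Fin 4 → ℤ) (ν : Fin 4) (y' : Fin 4 → ℤ),
      tadpole (GcombSh Lc j)
        ((1 / 2 : ℝ) • conjV (bhKStepSh 3 Lc (Dsh Lc) j) (diagK fun p a => (0 : ℕ → Fin 4 → Fin 4 → (Fin 4 → ℤ) → Fin 4 → (Fin 4 → ℤ) → (Fin 4 → ℤ) → Fib 3 → ℝ) j α ν y' μ y p a - (0 : ℕ → Fin 4 → Fin 4 → (Fin 4 → ℤ) → Fin 4 → (Fin 4 → ℤ) → (Fin 4 → ℤ) → Fib 3 → ℝ) j α μ y ν y' p a) +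
          (1 / 2 : ℝ) • (combΔAn1 Lc N cΛ (fun j => -((Lc : ℝ) ^ 8 / 2) * wVH 3 Lc j / (stepScale 3 Lc j * (Lc : ℝ) ^ 4)) (0 : ℕ → Fin 4 → Fin 4 → (Fin 4 → ℤ) → Fin 4 → (Fin 4 → ℤ) → (Fin 4 → ℤ) → Fib 3 → ℝ) j α μ y ν y' + combΔAn1 Lc N cΛ (fun j => -((Lc : ℝ) ^ 8 / 2) * wVH 3 Lc j / (stepScale 3 Lc j * (Lc : ℝ) ^ 4)) (0 : ℕ → Fin 4 → Fin 4 → (Fin 4 → ℤ) → Fin 4 → (Fin 4 → ℤ) → (Fin 4 → ℤ) → Fib 3 → ℝ) j α ν y' μ y)) = 0 :=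
  hRm0_of_hR2tad (Lc := Lc) hΛ N (hR2tad_all (Lc := Lc) hLc hN hΛ)

/-! ## §5 ROOT M‴: THE (III′) REPAIR-TRACK ROOT WITH ITS SCALAR DISCHARGED — `D1Drift ⟸ hΛ ∧ hcB ∧ D1Tel ∧ D1Rep` -/

/-- **ROW D1, CHART (III′) — ROOT M‴: `D1Drift (JsB12CombShSym …) ⟸ hΛ ∧ hcB ∧ D1Tel ∧ D1Rep`** (+ the route theorem's own binders: printed B5 facts
`h12`∕`h126`, window, `μ ≠ ν`, `Nc ≠ 0`, `2 ≤ Lc`, `Odd Lc`, `2 ≤ N`) — ROOT M″ `CombChartJointEndReflTablesAn1S2N.d1Drift_JsB12CombShSym_an1TablesS2_pinned_of_locks_hcomp_D1Tel_D1Rep`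
with its scalar `hRm0` SUPPLIED by §4 `hRm0_discharged`.  WHAT IS LEFT DISPLAYED: the two unit locks of an1's table fit (`hΛ`, `hcB` — numerals), the telescoping
binder `D1Tel` (road FP) and the representation binder `D1Rep` (road BF-x).  The reflection binder hR of the (III′) repair track is thereby DISCHARGED IN THE KERNEL
(hW was already table letters = theorems).  HONEST: composition by name over OUR typed objects; `D1Tel`, `D1Rep` OPEN (the roads'); nothing of Bałaban's
asserted or discharged; the ROOT OF RECORD is the referee's to name; NOT D1, NOT `BetaPertH`, NOT continuum, NOT Clay. -/
theorem d1Drift_JsB12CombShSym_an1TablesS2_pinned_of_locks_D1Tel_D1Rep (hLc : Odd Lc) (hL2 : 2 ≤ Lc) {N : ℕ} (hN : 2 ≤ N) (cΛ cB : ℝ)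
    -- the two unit locks of an1's TABLE-FIT tier 2
    (hΛ : cΛ * (Lc : ℝ) ^ 4 = 2) (hcB : cB = -((Lc : ℝ) ^ 12 / 4))
    -- the route theorem's own binders, verbatim
    (a : ℝ) (ha : 0 < a)
    (h12 : B5.Prop12Printed (fam (fun i : ℕ+ × ℕ => ((i.1 : ℕ+) : ℕ)) (fun i => i.1.pos) MvE a ha))
    (h126 : B5.Kernel126_127Printed (kfam (fun i : ℕ+ × ℕ => ((i.1 : ℕ+) : ℕ)) MvE))
    {L : Type*} {SL : Finset L} (hSL : SL.Nonempty) (k : L → Fin 4) {μ ν : Fin 4} (hμν : μ ≠ ν) {Nc : ℝ} (hNc : Nc ≠ 0)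
    (Jc : ∀ m : ℕ, JetData 3 (Lc ^ m))
    (htel : D1Tel Lc (JsB12CombShSym hLc N (symTablesAn1S2 3 Lc cΛ) cΛ cB) Jc)
    {cc : ℝ} {Mw' : ℕ → ℕ} (hc : 1 ≤ cc) (hMwin : ∀ L : ℕ, 2 ≤ L → 1 ≤ Mw' L ∧ (L : ℝ) ≤ cc * Mw' L) (hML : ∀ L : ℕ, 2 ≤ L → Mw' L ≤ L)
    (hrep : D1Rep Lc Jc Nc μ ν a SL k) :
    D1Drift Lc (JsB12CombShSym hLc N (symTablesAn1S2 3 Lc cΛ) cΛ cB) Nc μ ν :=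
  d1Drift_JsB12CombShSym_an1TablesS2_pinned_of_locks_hcomp_D1Tel_D1Rep hLc hL2 hN cΛ cB hΛ hcB (hRm0_discharged (Lc := Lc) hLc hN hΛ)
    a ha h12 h126 hSL k hμν hNc Jc htel hc hMwin hML hrep

end Summit.QuantumFields.BalabanUV.Beta.CombRemainderParityAll

end
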